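import Summits.Ventures.LatticeQCDFlow.Scoring.FreeFieldLeapfrogEquilibriumEnergy
import Literature.Probability.Distributions.GaussianMoments
import HarnessLib

/-!
# The variance of the free-field leapfrog energy violation, exactly: `Var(ΔH) = 2⟨ΔH⟩(1 + ⟨ΔH⟩)` per mode

HONEST FRAMING: exact (Metropolis-corrected) sampling algorithms for lattice gauge theory;
figures of merit are autocorrelation/cost numbers at stated couplings and volumes; no
continuum-physics claim.  (SCALAR calibration rung S0-A: not a gauge result.)

Venture `LatticeQCDFlow` (cell pub-lqcd), sub-topic `Scoring`; FANOUT row 2 (`s0-phi4`: the HMC arm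
of the 2D φ⁴ calibration).  NEW WORK of the cell over Mathlib and the tree's Gaussian moments
(`Literature.Probability.Distributions.integral_pow_even_gaussianReal`, Janson 1997 Rem. 1.30);
nothing is cited as a fact.  Printed counterparts, named only: Gupta–Irbäck–Karsch–Petersson 1990
and Kennedy–Pendleton 1991 (`Var(ΔH) ≈ 2⟨ΔH⟩` for leapfrog at small step size, the input of the
`erfc(½√⟨ΔH⟩)` acceptance law), Creutz 1988.

`Scoring/FreeFieldLeapfrogEquilibriumEnergy.lean` (row 2) computed the MEAN violation of one
free mode under its exact law `N(0, 1/Ω²) ⊗ N(0, 1)`: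
`m := ⟨ΔH_N⟩ = δ⁴Ω⁴ sin²(Nθ)/(32(1 − δ²Ω²/4))` (`meanEnergyViolation δ Ω² N`), and left
"`Var(ΔH) = 2⟨ΔH⟩ + O(δ⁶)`" NOT CLAIMED.  Here the second moment is computed EXACTLY and the
remainder turns out to be closed: no `O(δ⁶)` — an identity.

## What is proved (one mode `Ω² = w2 > 0`, `δ > 0`, stable regime `δ²Ω² < 4`)

* §1 `modeEnergyViolation δ Ω² N z = H(lfMode^[N] z) − H(z)`; `modeEnergyViolation_eq_quadForm` —
  it is the quadratic form `A O² − B OP + C P²`, `A = k s²/β²`, `B = 2k s c/β`, `C = k(c² − 1)`,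
  `k = δ²Ω²/8`, `s, c = sin, cos (Nθ)`, `β² = (1 − δ²Ω²/4)/Ω²`.
* §2 `sq_energy_violation_of_moments` — for ANY law with the Gaussian fourth moments
  (`∫O⁴ = 3/Ω⁴`, `∫O³P = 0`, `∫O²P² = 1/Ω²`, `∫OP³ = 0`, `∫P⁴ = 3`): `∫ ΔH_N² = 2m + 3m²`
  (pure algebra: `energy_violation_sq_algebra`).
* §3 the exact law HAS those moments (`integral_fst_pow_four_modeGibbsLaw`, …), hence the
  headlines **`leapfrog_energy_violation_sq`** `∫ ΔH_N² dγ = 2m + 3m²` and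
  **`leapfrog_energy_violation_variance`** `∫ (ΔH_N − m)² dγ = 2m(1 + m)` — for every `δ`, `N`
  in the stable regime: `Var(ΔH) = 2⟨ΔH⟩` holds to leading order with the EXACT, POSITIVE
  remainder `2⟨ΔH⟩²` (`two_mul_mean_le_variance`; the per-mode law of `ΔH` is therefore not
  Gaussian, whose fluctuation relation would force `Var = 2⟨ΔH⟩` on the nose).
* §4 lattice reading as algebra: the lattice `ΔH` is the sum of the `V` independent modes, so
  `Var_V = Σ_k 2m_k(1 + m_k)` and `2⟨ΔH⟩_V ≤ Var_V ≤ 2⟨ΔH⟩_V (1 + max_k m_k)`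
  (`sum_mode_variance_bounds`): a statistics-free CHECK for the exactness battery's HMC leg at
  `λ = 0` — the stored `dH` series must have `Var(dH)/(2·mean(dH)) ∈ [1, 1 + m_max]`,
  `m_max ≤ δ⁴Ω_max⁴/(32(1 − δ²Ω_max²/4))` (`meanEnergyViolation_le`).
NOT CLAIMED: the law of `ΔH` beyond two moments, the acceptance `erfc` formula, anything at `λ > 0`.
-/

namespace Summit.Ventures.LatticeQCDFlow.Scoring

open Real MeasureTheory ProbabilityTheory Filter

/-! ## §1 The energy violation of one mode as a quadratic form -/

section QuadForm

variable {δ w2 : ℝ}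

/-- The energy violation of one free mode after `N` leapfrog steps of size `δ`:
`ΔH_N(z) = H(lfMode^[N] z) − H(z)`, `H(O, P) = ½(Ω²O² + P²)`. -/
noncomputable def modeEnergyViolation (δ w2 : ℝ) (N : ℕ) (z : ℝ × ℝ) : ℝ :=
  (w2 * ((lfMode δ w2)^[N] z).1 ^ 2 + ((lfMode δ w2)^[N] z).2 ^ 2) / 2 - (w2 * z.1 ^ 2 + z.2 ^ 2) / 2

/-- **Quadratic form.**  `ΔH_N(O, P) = A O² − B OP + C P²` with `A = k (s/β)²`, `B = 2k (s/β) c`,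
`C = k (c² − 1)`, `k = δ²Ω²/8`, `s = sin(Nθ)`, `c = cos(Nθ)`, `θ = arccos(1 − δ²Ω²/2)`,
`β = δ(1 − δ²Ω²/4)/sin θ`. -/
theorem modeEnergyViolation_eq_quadForm (hδ : 0 < δ) (hw : 0 < w2) (hst : δ ^ 2 * w2 < 4)
    (N : ℕ) (z : ℝ × ℝ) :
    modeEnergyViolation δ w2 N z
      = δ ^ 2 * w2 / 8 * (Real.sin (N * Real.arccos (1 - δ ^ 2 * w2 / 2))
            / (δ * (1 - δ ^ 2 * w2 / 4) / Real.sin (Real.arccos (1 - δ ^ 2 * w2 / 2)))) ^ 2 * z.1 ^ 2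
        - δ ^ 2 * w2 / 8 * (2 * (Real.sin (N * Real.arccos (1 - δ ^ 2 * w2 / 2))
            / (δ * (1 - δ ^ 2 * w2 / 4) / Real.sin (Real.arccos (1 - δ ^ 2 * w2 / 2))))
            * Real.cos (N * Real.arccos (1 - δ ^ 2 * w2 / 2))) * (z.1 * z.2)
        + δ ^ 2 * w2 / 8 * (Real.cos (N * Real.arccos (1 - δ ^ 2 * w2 / 2)) ^ 2 - 1) * z.2 ^ 2 := by
  unfold modeEnergyViolation
  rw [energyViolation_rotation hδ hw hst z N]
  ring

end QuadForm

/-! ## §2 The second moment from the Gaussian fourth moments: pure algebra -/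

section Algebra

/-- **The algebraic core.**  With `k = δ²Ω²/8`, `β² = (1 − δ²Ω²/4)/Ω²`, `s² + c² = 1` and the
Gaussian fourth moments inserted, `E[ΔH²] = 3A²/Ω⁴ + (B² + 2AC)/Ω² + 3C²` equals `2m + 3m²`,
`m = δ⁴Ω⁴ s²/(32(1 − δ²Ω²/4))`. -/
theorem energy_violation_sq_algebra {δ w2 β s c : ℝ} (hδ : 0 < δ) (hw : 0 < w2)
    (hst : δ ^ 2 * w2 < 4) (hβ2 : β ^ 2 = (1 - δ ^ 2 * w2 / 4) / w2) (hsc : s ^ 2 + c ^ 2 = 1) :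
    (δ ^ 2 * w2 / 8 * (s / β) ^ 2) ^ 2 * (3 / w2 ^ 2)
      + ((δ ^ 2 * w2 / 8 * (2 * (s / β) * c)) ^ 2
          + 2 * (δ ^ 2 * w2 / 8 * (s / β) ^ 2) * (δ ^ 2 * w2 / 8 * (c ^ 2 - 1))) * (1 / w2)
      + (δ ^ 2 * w2 / 8 * (c ^ 2 - 1)) ^ 2 * 3
      = 2 * (δ ^ 4 * w2 ^ 2 * s ^ 2 / (32 * (1 - δ ^ 2 * w2 / 4)))
        + 3 * (δ ^ 4 * w2 ^ 2 * s ^ 2 / (32 * (1 - δ ^ 2 * w2 / 4))) ^ 2 := by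
  have hq : 0 < 1 - δ ^ 2 * w2 / 4 := by nlinarith
  have hc2 : c ^ 2 = 1 - s ^ 2 := by linarith
  have e1 : (δ ^ 2 * w2 / 8 * (2 * (s / β) * c)) ^ 2
      = 4 * (δ ^ 2 * w2 / 8) ^ 2 * (s / β) ^ 2 * c ^ 2 := by ring
  rw [e1, div_pow, hβ2, hc2]
  have hq4 : 4 - δ ^ 2 * w2 ≠ 0 := by linarith
  have hw0 : w2 ≠ 0 := hw.ne'
  have hδ0 : δ ≠ 0 := hδ.ne'
  field_simp
  ring

end Algebra

section Moments

variable {δ w2 : ℝ}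

/-- **Second moment of the energy violation from the fourth moments.**  For ANY measure `ν` on
the mode's phase space with the fourth moments of the exact law (`∫O⁴ = 3/Ω⁴`, `∫O³P = 0`,
`∫O²P² = 1/Ω²`, `∫OP³ = 0`, `∫P⁴ = 3`, all integrable): `∫ ΔH_N² dν = 2m + 3m²`,
`m = meanEnergyViolation δ Ω² N`. -/
theorem sq_energy_violation_of_moments (hδ : 0 < δ) (hw : 0 < w2) (hst : δ ^ 2 * w2 < 4)
    (N : ℕ) (ν : Measure (ℝ × ℝ))
    (h40 : Integrable (fun z : ℝ × ℝ => z.1 ^ 4) ν)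
    (h31 : Integrable (fun z : ℝ × ℝ => z.1 ^ 3 * z.2) ν)
    (h22 : Integrable (fun z : ℝ × ℝ => z.1 ^ 2 * z.2 ^ 2) ν)
    (h13 : Integrable (fun z : ℝ × ℝ => z.1 * z.2 ^ 3) ν)
    (h04 : Integrable (fun z : ℝ × ℝ => z.2 ^ 4) ν)
    (e40 : ∫ z, z.1 ^ 4 ∂ν = 3 / w2 ^ 2) (e31 : ∫ z, z.1 ^ 3 * z.2 ∂ν = 0)
    (e22 : ∫ z, z.1 ^ 2 * z.2 ^ 2 ∂ν = 1 / w2) (e13 : ∫ z, z.1 * z.2 ^ 3 ∂ν = 0)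
    (e04 : ∫ z, z.2 ^ 4 ∂ν = 3) :
    ∫ z, modeEnergyViolation δ w2 N z ^ 2 ∂ν
      = 2 * meanEnergyViolation δ w2 N + 3 * meanEnergyViolation δ w2 N ^ 2 := by
  set s := Real.sin (N * Real.arccos (1 - δ ^ 2 * w2 / 2)) with hs
  set c := Real.cos (N * Real.arccos (1 - δ ^ 2 * w2 / 2)) with hc
  set β := δ * (1 - δ ^ 2 * w2 / 4) / Real.sin (Real.arccos (1 - δ ^ 2 * w2 / 2)) with hβ
  have hβ2 : β ^ 2 = (1 - δ ^ 2 * w2 / 4) / w2 := by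
    rw [hβ, rotation_beta_sq hδ.ne' hw hst, shadowVariance_eq hw.ne']
  have hsc : s ^ 2 + c ^ 2 = 1 := Real.sin_sq_add_cos_sq _
  set A := δ ^ 2 * w2 / 8 * (s / β) ^ 2 with hA
  set B := δ ^ 2 * w2 / 8 * (2 * (s / β) * c) with hB
  set C := δ ^ 2 * w2 / 8 * (c ^ 2 - 1) with hC
  -- pointwise expansion of the square of the quadratic form
  have hpt : ∀ z : ℝ × ℝ, modeEnergyViolation δ w2 N z ^ 2
      = A ^ 2 * z.1 ^ 4 - 2 * A * B * (z.1 ^ 3 * z.2) + (B ^ 2 + 2 * A * C) * (z.1 ^ 2 * z.2 ^ 2)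
        - 2 * B * C * (z.1 * z.2 ^ 3) + C ^ 2 * z.2 ^ 4 := by
    intro z
    rw [modeEnergyViolation_eq_quadForm hδ hw hst N z]
    ring
  simp_rw [hpt]
  have i1 : Integrable (fun z : ℝ × ℝ => A ^ 2 * z.1 ^ 4) ν := h40.const_mul _
  have i2 : Integrable (fun z : ℝ × ℝ => 2 * A * B * (z.1 ^ 3 * z.2)) ν := h31.const_mul _
  have i3 : Integrable (fun z : ℝ × ℝ => (B ^ 2 + 2 * A * C) * (z.1 ^ 2 * z.2 ^ 2)) ν :=
    h22.const_mul _
  have i4 : Integrable (fun z : ℝ × ℝ => 2 * B * C * (z.1 * z.2 ^ 3)) ν := h13.const_mul _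
  have i5 : Integrable (fun z : ℝ × ℝ => C ^ 2 * z.2 ^ 4) ν := h04.const_mul _
  have i12 : Integrable (fun z : ℝ × ℝ => A ^ 2 * z.1 ^ 4 - 2 * A * B * (z.1 ^ 3 * z.2)) ν :=
    i1.sub i2
  have i123 : Integrable (fun z : ℝ × ℝ => A ^ 2 * z.1 ^ 4 - 2 * A * B * (z.1 ^ 3 * z.2)
      + (B ^ 2 + 2 * A * C) * (z.1 ^ 2 * z.2 ^ 2)) ν := i12.add i3
  have i1234 : Integrable (fun z : ℝ × ℝ => A ^ 2 * z.1 ^ 4 - 2 * A * B * (z.1 ^ 3 * z.2)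
      + (B ^ 2 + 2 * A * C) * (z.1 ^ 2 * z.2 ^ 2) - 2 * B * C * (z.1 * z.2 ^ 3)) ν := i123.sub i4
  rw [integral_add i1234 i5, integral_sub i123 i4, integral_add i12 i3, integral_sub i1 i2,
    integral_const_mul, integral_const_mul, integral_const_mul, integral_const_mul,
    integral_const_mul, e40, e31, e22, e13, e04, mul_zero, mul_zero, sub_zero, sub_zero]
  unfold meanEnergyViolation
  rw [← energy_violation_sq_algebra hδ hw hst hβ2 hsc]

end Moments

/-! ## §3 The exact law has the Gaussian fourth moments: the headline -/

section Gaussian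

open Literature.Probability.Distributions

variable {w2 : ℝ}

/-- `∫ x⁴ dN(0, v) = 3v²`. -/
theorem integral_pow_four_gaussianReal (v : NNReal) :
    ∫ x, x ^ 4 ∂gaussianReal 0 v = 3 * (v : ℝ) ^ 2 := by
  have h := integral_pow_even_gaussianReal v 2
  norm_num [Nat.doubleFactorial] at h
  rw [h]
  ring

/-- `∫ x³ dN(0, v) = 0`. -/
theorem integral_pow_three_gaussianReal (v : NNReal) : ∫ x, x ^ 3 ∂gaussianReal 0 v = 0 := by
  have h := integral_pow_odd_gaussianReal v 1
  norm_num at h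
  exact h

/-- `∫ O⁴ = 3/Ω⁴` under the exact law. -/
theorem integral_fst_pow_four_modeGibbsLaw (hw : 0 < w2) :
    ∫ z, z.1 ^ 4 ∂modeGibbsLaw w2 = 3 / w2 ^ 2 := by
  unfold modeGibbsLaw
  have h := integral_prod_mul (μ := gaussianReal 0 (1 / w2).toNNReal) (ν := gaussianReal 0 1)
    (fun x : ℝ => x ^ 4) (fun _ : ℝ => (1 : ℝ))
  simp only [mul_one, integral_const, probReal_univ, smul_eq_mul] at h
  rw [h, integral_pow_four_gaussianReal, Real.coe_toNNReal _ (by positivity)]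
  field_simp

/-- `∫ O³P = 0` under the exact law. -/
theorem integral_fst_pow_three_mul_snd_modeGibbsLaw (w2 : ℝ) :
    ∫ z, z.1 ^ 3 * z.2 ∂modeGibbsLaw w2 = 0 := by
  unfold modeGibbsLaw
  rw [integral_prod_mul (fun x : ℝ => x ^ 3) (fun y : ℝ => y), integral_id_gaussianReal, mul_zero]

/-- `∫ O²P² = 1/Ω²` under the exact law. -/
theorem integral_fst_sq_mul_snd_sq_modeGibbsLaw (hw : 0 < w2) :
    ∫ z, z.1 ^ 2 * z.2 ^ 2 ∂modeGibbsLaw w2 = 1 / w2 := by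
  unfold modeGibbsLaw
  rw [integral_prod_mul (fun x : ℝ => x ^ 2) (fun y : ℝ => y ^ 2), integral_sq_gaussianReal,
    integral_sq_gaussianReal, Real.coe_toNNReal _ (by positivity)]
  simp

/-- `∫ OP³ = 0` under the exact law. -/
theorem integral_fst_mul_snd_pow_three_modeGibbsLaw (w2 : ℝ) :
    ∫ z, z.1 * z.2 ^ 3 ∂modeGibbsLaw w2 = 0 := by
  unfold modeGibbsLaw
  rw [integral_prod_mul (fun x : ℝ => x) (fun y : ℝ => y ^ 3), integral_id_gaussianReal, zero_mul]

/-- `∫ P⁴ = 3` under the exact law. -/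
theorem integral_snd_pow_four_modeGibbsLaw (w2 : ℝ) :
    ∫ z, z.2 ^ 4 ∂modeGibbsLaw w2 = 3 := by
  unfold modeGibbsLaw
  have h := integral_prod_mul (μ := gaussianReal 0 (1 / w2).toNNReal) (ν := gaussianReal 0 1)
    (fun _ : ℝ => (1 : ℝ)) (fun y : ℝ => y ^ 4)
  simp only [one_mul, integral_const, probReal_univ, smul_eq_mul] at h
  rw [h, integral_pow_four_gaussianReal]
  simp

/-- The five quartic observables are integrable under the exact law. -/
theorem integrable_fourth_moments_modeGibbsLaw (w2 : ℝ) :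
    Integrable (fun z : ℝ × ℝ => z.1 ^ 4) (modeGibbsLaw w2)
      ∧ Integrable (fun z : ℝ × ℝ => z.1 ^ 3 * z.2) (modeGibbsLaw w2)
      ∧ Integrable (fun z : ℝ × ℝ => z.1 ^ 2 * z.2 ^ 2) (modeGibbsLaw w2)
      ∧ Integrable (fun z : ℝ × ℝ => z.1 * z.2 ^ 3) (modeGibbsLaw w2)
      ∧ Integrable (fun z : ℝ × ℝ => z.2 ^ 4) (modeGibbsLaw w2) := by
  unfold modeGibbsLaw
  refine ⟨?_, ?_, ?_, ?_, ?_⟩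
  · have h := (integrable_pow_gaussianReal 0 (1 / w2).toNNReal 4).mul_prod
      (integrable_const (1 : ℝ) (μ := gaussianReal 0 1))
    simpa using h
  · have h := (integrable_pow_gaussianReal 0 (1 / w2).toNNReal 3).mul_prod
      (integrable_pow_gaussianReal 0 1 1)
    simpa using h
  · exact (integrable_pow_gaussianReal 0 (1 / w2).toNNReal 2).mul_prod
      (integrable_pow_gaussianReal 0 1 2)
  · have h := (integrable_pow_gaussianReal 0 (1 / w2).toNNReal 1).mul_prod
      (integrable_pow_gaussianReal 0 1 3)
    simpa using h
  · have h := (integrable_const (1 : ℝ) (μ := gaussianReal 0 (1 / w2).toNNReal)).mul_prod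
      (integrable_pow_gaussianReal 0 1 4)
    simpa using h

/-- **THE SECOND MOMENT OF THE ENERGY VIOLATION, EXACTLY**: under the exact law of the mode,
`∫ ΔH_N² = 2m + 3m²`, `m = ⟨ΔH_N⟩ = meanEnergyViolation δ Ω² N`. -/
theorem leapfrog_energy_violation_sq {δ : ℝ} (hδ : 0 < δ) (hw : 0 < w2) (hst : δ ^ 2 * w2 < 4)
    (N : ℕ) :
    ∫ z, modeEnergyViolation δ w2 N z ^ 2 ∂modeGibbsLaw w2
      = 2 * meanEnergyViolation δ w2 N + 3 * meanEnergyViolation δ w2 N ^ 2 := by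
  obtain ⟨h40, h31, h22, h13, h04⟩ := integrable_fourth_moments_modeGibbsLaw w2
  exact sq_energy_violation_of_moments hδ hw hst N _ h40 h31 h22 h13 h04
    (integral_fst_pow_four_modeGibbsLaw hw) (integral_fst_pow_three_mul_snd_modeGibbsLaw w2)
    (integral_fst_sq_mul_snd_sq_modeGibbsLaw hw) (integral_fst_mul_snd_pow_three_modeGibbsLaw w2)
    (integral_snd_pow_four_modeGibbsLaw w2)

/-- The mean, restated for the named violation: `∫ ΔH_N = m`. -/
theorem leapfrog_energy_violation_mean {δ : ℝ} (hδ : 0 < δ) (hw : 0 < w2) (hst : δ ^ 2 * w2 < 4)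
    (N : ℕ) :
    ∫ z, modeEnergyViolation δ w2 N z ∂modeGibbsLaw w2 = meanEnergyViolation δ w2 N := by
  unfold modeEnergyViolation meanEnergyViolation
  exact leapfrog_mean_energy_violation hδ hw hst N

/-- `ΔH_N` is integrable under the exact law (a quadratic form in Gaussian variables). -/
theorem integrable_modeEnergyViolation {δ : ℝ} (hδ : 0 < δ) (hw : 0 < w2)
    (hst : δ ^ 2 * w2 < 4) (N : ℕ) :
    Integrable (modeEnergyViolation δ w2 N) (modeGibbsLaw w2) := by
  obtain ⟨h1, h2, h3⟩ := integrable_moments_modeGibbsLaw w2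
  have e : modeEnergyViolation δ w2 N = fun z => _ := funext (modeEnergyViolation_eq_quadForm hδ hw hst N)
  rw [e]
  exact ((h1.const_mul _).sub (h2.const_mul _)).add (h3.const_mul _)

/-- `ΔH_N²` is integrable under the exact law. -/
theorem integrable_modeEnergyViolation_sq {δ : ℝ} (hδ : 0 < δ) (hw : 0 < w2)
    (hst : δ ^ 2 * w2 < 4) (N : ℕ) :
    Integrable (fun z => modeEnergyViolation δ w2 N z ^ 2) (modeGibbsLaw w2) := by
  obtain ⟨h40, h31, h22, h13, h04⟩ := integrable_fourth_moments_modeGibbsLaw w2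
  set s := Real.sin (N * Real.arccos (1 - δ ^ 2 * w2 / 2)) with hs
  set c := Real.cos (N * Real.arccos (1 - δ ^ 2 * w2 / 2)) with hc
  set β := δ * (1 - δ ^ 2 * w2 / 4) / Real.sin (Real.arccos (1 - δ ^ 2 * w2 / 2)) with hβ
  set A := δ ^ 2 * w2 / 8 * (s / β) ^ 2 with hA
  set B := δ ^ 2 * w2 / 8 * (2 * (s / β) * c) with hB
  set C := δ ^ 2 * w2 / 8 * (c ^ 2 - 1) with hC
  have hpt : (fun z => modeEnergyViolation δ w2 N z ^ 2)
      = fun z : ℝ × ℝ => A ^ 2 * z.1 ^ 4 - 2 * A * B * (z.1 ^ 3 * z.2)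
        + (B ^ 2 + 2 * A * C) * (z.1 ^ 2 * z.2 ^ 2) - 2 * B * C * (z.1 * z.2 ^ 3) + C ^ 2 * z.2 ^ 4 := by
    funext z
    rw [modeEnergyViolation_eq_quadForm hδ hw hst N z]
    ring
  rw [hpt]
  exact ((((h40.const_mul _).sub (h31.const_mul _)).add (h22.const_mul _)).sub
    (h13.const_mul _)).add (h04.const_mul _)

/-- **THE VARIANCE OF THE ENERGY VIOLATION, EXACTLY: `Var(ΔH_N) = 2⟨ΔH_N⟩(1 + ⟨ΔH_N⟩)`** per
free mode under its exact law, for every `δ > 0`, `N`, in the stable regime — `Var = 2·mean` to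
leading order with the exact positive remainder `2·mean²`. -/
theorem leapfrog_energy_violation_variance {δ : ℝ} (hδ : 0 < δ) (hw : 0 < w2)
    (hst : δ ^ 2 * w2 < 4) (N : ℕ) :
    ∫ z, (modeEnergyViolation δ w2 N z - meanEnergyViolation δ w2 N) ^ 2 ∂modeGibbsLaw w2
      = 2 * meanEnergyViolation δ w2 N * (1 + meanEnergyViolation δ w2 N) := by
  set m := meanEnergyViolation δ w2 N with hm
  have hsq := integrable_modeEnergyViolation_sq hδ hw hst N
  have hlin := integrable_modeEnergyViolation hδ hw hst N
  have hpt : ∀ z, (modeEnergyViolation δ w2 N z - m) ^ 2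
      = modeEnergyViolation δ w2 N z ^ 2 - 2 * m * modeEnergyViolation δ w2 N z + m ^ 2 := by
    intro z; ring
  simp_rw [hpt]
  have hl2 : Integrable (fun z => 2 * m * modeEnergyViolation δ w2 N z) (modeGibbsLaw w2) :=
    hlin.const_mul _
  have hA : Integrable (fun z => modeEnergyViolation δ w2 N z ^ 2
      - 2 * m * modeEnergyViolation δ w2 N z) (modeGibbsLaw w2) := hsq.sub hl2
  rw [integral_add hA (integrable_const _), integral_sub hsq hl2, integral_const_mul,
    integral_const, probReal_univ, leapfrog_energy_violation_sq hδ hw hst N,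
    leapfrog_energy_violation_mean hδ hw hst N]
  simp only [smul_eq_mul, one_mul]
  ring

/-- **`Var(ΔH_N) ≥ 2⟨ΔH_N⟩`**, with equality iff the mode is at a resonance (`m = 0`). -/
theorem two_mul_mean_le_variance {δ : ℝ} (hδ : 0 < δ) (hw : 0 < w2) (hst : δ ^ 2 * w2 < 4)
    (N : ℕ) :
    2 * meanEnergyViolation δ w2 N
      ≤ ∫ z, (modeEnergyViolation δ w2 N z - meanEnergyViolation δ w2 N) ^ 2 ∂modeGibbsLaw w2 := by
  rw [leapfrog_energy_violation_variance hδ hw hst N]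
  have h0 := meanEnergyViolation_nonneg (w2 := w2) hst N
  nlinarith

/-- **Uniform in the trajectory length**: `Var(ΔH_N) ≤ 2⟨ΔH_N⟩(1 + m_sup)`,
`m_sup = δ⁴Ω⁴/(32(1 − δ²Ω²/4))`. -/
theorem variance_le {δ : ℝ} (hδ : 0 < δ) (hw : 0 < w2) (hst : δ ^ 2 * w2 < 4) (N : ℕ) :
    ∫ z, (modeEnergyViolation δ w2 N z - meanEnergyViolation δ w2 N) ^ 2 ∂modeGibbsLaw w2
      ≤ 2 * meanEnergyViolation δ w2 N * (1 + δ ^ 4 * w2 ^ 2 / (32 * (1 - δ ^ 2 * w2 / 4))) := by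
  rw [leapfrog_energy_violation_variance hδ hw hst N]
  have h0 := meanEnergyViolation_nonneg (w2 := w2) hst N
  have h1 := meanEnergyViolation_le (w2 := w2) hst N
  nlinarith

end Gaussian

/-! ## §4 Summing independent modes: the lattice check -/

section Lattice

/-- **Lattice reading, as algebra.**  If the per-mode means `m_k ≥ 0` are bounded by `M`, then the
sum of the per-mode variances `Σ 2m_k(1 + m_k)` (the lattice `Var(ΔH)` for independent modes)
lies between `2 Σ m_k` and `2 (Σ m_k)(1 + M)`: `Var(ΔH)/(2⟨ΔH⟩) ∈ [1, 1 + M]`. -/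
theorem sum_mode_variance_bounds {ι : Type*} (s : Finset ι) (m : ι → ℝ) {M : ℝ}
    (h0 : ∀ k ∈ s, 0 ≤ m k) (hM : ∀ k ∈ s, m k ≤ M) :
    2 * ∑ k ∈ s, m k ≤ ∑ k ∈ s, 2 * m k * (1 + m k)
      ∧ ∑ k ∈ s, 2 * m k * (1 + m k) ≤ 2 * (∑ k ∈ s, m k) * (1 + M) := by
  constructor
  · rw [Finset.mul_sum]
    exact Finset.sum_le_sum fun k hk => by nlinarith [h0 k hk]
  · rw [Finset.mul_sum, Finset.sum_mul]
    exact Finset.sum_le_sum fun k hk => by nlinarith [h0 k hk, hM k hk]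

end Lattice

end Summit.Ventures.LatticeQCDFlow.Scoring
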